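import Literature.Analysis.FluidPDE.NSRobustnessOfRegularityDissipation
import HarnessLib

/-!
# Robustness of regularity on `ℝ³`, smoothing vein III: `H¹ → H²` PARABOLIC SMOOTHING of the
# difference of two classical solutions in strain currency, and the Agmon readout

Analysis/FluidPDE proof file (theorems only; no definitions, no named facts, no `sorry`); sixth file
of the vein `NSRobustnessOfRegularity` → `…H2` → `…SupNorm` → `…HalfFlux` → `…Dissipation`.
The preceding files bound the `H²` defect `Z(t) = Σᵢ∫|∇∂ᵢ(v − u)(t)|²_F` of two classical solutions
in terms of ITS INITIAL VALUE `Z(t₀)`; here `Z(t₀)` is removed by the parabolic smoothing step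
(Constantin–Foias 1988 Ch. 10 / RRS 2016 Thm 6.8, `t‖Au‖²`, Chebyshev form): the dissipation of the
`H¹` balance pays for one time `a ∈ [0, T/2]` of small `H²` defect, and Dashti–Robinson's `H²` letter
(`classicalNS_robustness_H2_strain_window_of_le_R3`) is run from `a`.

* `classicalNS_H2_smoothing_strain_R3` — **`H¹ → H²` smoothing, a priori, strain form**: class
  hypotheses on `[0, T]`, continuous majorants `G, σ₂, σ₃, L, X₁, H₀, H₁, ψ`, free lengths `κ, μ`,
  dissipation budget `D ≥ X₁(0) + ∫₀ᵀ φ` (`φ = (4G + 3κσ₂)X₁ + 4A⁴X₁³/ν³ + 4H₀/ν + 3σ₂L²/κ`),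
  `Ψ₂ ≥ ∫₀ᵀψ` (`ψ ≥ 27σ₂X₁/κ + 9σ₃L²/κ² + 6H₁/ν`), rate
  `l = 6G + 9κσ₂ + 3κ²σ₃ + 3A²X₁/(νμ) + 27A⁴X₁²/(16ν³)`, `β = A²μ/ν`, `η = 2D/(νT) + Ψ₂`:
  if `βe^{∫₀ᵀ l}ηT < 1` then `Z(t) ≤ e^{∫₀ᵗ l}η/(1 − βe^{∫₀ᵀ l}ηT)` for every `t` in the SECOND
  HALF `[T/2, T]` — NO hypothesis on `Z(0)`.
* `classicalNS_norm_sub_le_H2_smoothing_R3` — the Agmon readout on `[T/2, T]`: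
  `‖v(t,x) − u(t,x)‖ ≤ A(3X₁(t)·e^{∫₀ᵗ l}η/(1 − βe^{∫₀ᵀ l}ηT))^{1/4}`.

Price (for the consumer, cell `ns-blowup`, crux 20303 `EpisodeBaseT`, hybrid door (A′)): over a
window of ONE strain time `T = 1/A₁` the fee `e^{∫l}` is `O(e^{6})` and the smoothing costs the
factor `2/(νT)` on the `H¹` budget — the `H²` letter is never run over the long window.
WHAT THIS IS NOT: not a statement about Navier–Stokes regularity or blow-up — a-priori calculus
between two GIVEN classical solutions; the existence half is not here.

## Mathlib / tree search

Tree: `IsClassicalNSSolutionOn.dissipation_sub_le_R3`, `…hessianDefect_eq_laplacian_and_continuousOn`,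
`classicalNS_robustness_H2_strain_window_of_le_R3`,
`classicalNS_norm_sub_le_of_H1_H2_R3`, `IsSmoothSpaceTimeOn.timeDerivWithin_eq_of_subset`,
`IsClassicalNSSolutionOn.mono`, `HasBoundedSobolevNormsOn.mono`. Mathlib: `IsCompact.exists_isMinOn`,
`intervalIntegral.integral_mono_on`, `intervalIntegral.integral_mono_interval`. `lean search 'H2Smoothing'`: torus
twins `TorusClassicalNSH2Smoothing` / `TorusLinearisedNSH2Smoothing` only; no `ℝ³` difference form.

## References

* P. Constantin, C. Foias, *Navier–Stokes Equations*, Univ. Chicago Press 1988, Ch. 10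
  (parabolic smoothing of strong solutions, the `t‖Au‖²` estimate). [ConstantinFoias1988]
* J. C. Robinson, J. L. Rodrigo, W. Sadowski, *The Three-Dimensional Navier–Stokes Equations*,
  CUP 2016, Thm 6.8 (proof), Thm 9.1, Thm 1.20. [RobinsonRodrigoSadowskiCUP2016]
* M. Dashti, J. C. Robinson, SIAM J. Numer. Anal. 46 (2008) 3136–3150, Thm 2. [DashtiRobinson2008]
* E. M. Stein, *Singular Integrals and Differentiability Properties of Functions*, Princeton 1970,
  Ch. III §1.3. [Stein1971]
-/

noncomputable section

open MeasureTheory Set Function Filter Topology InnerProductSpace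
open scoped ENNReal NNReal ContDiff RealInnerProductSpace Laplacian

namespace Literature.Analysis.FluidPDE

/-! ## §A Bookkeeping repeated from the preceding files of the vein (private) -/

section Helpers

/-- A bound of the compression rate of a divergence-free field is nonnegative (trace). [folklore] -/
private theorem h2s_compressionRate_nonneg
    {u₀ : EuclideanSpace ℝ (Fin 3) → EuclideanSpace ℝ (Fin 3)} (hdiv : VectorCalculus.IsDivFree u₀)
    {G : ℝ} (hG : ∀ (x ξ : EuclideanSpace ℝ (Fin 3)), -⟪fderiv ℝ u₀ x ξ, ξ⟫ ≤ G * ‖ξ‖ ^ 2) :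
    0 ≤ G := by
  have hd := hdiv 0
  rw [divergence_eq_sum_inner_fderiv (EuclideanSpace.basisFun (Fin 3) ℝ), Fin.sum_univ_three] at hd
  have he : ∀ i, ‖EuclideanSpace.basisFun (Fin 3) ℝ i‖ = 1 := fun i => by simp
  have h0 := hG 0 (EuclideanSpace.basisFun (Fin 3) ℝ 0)
  have h1 := hG 0 (EuclideanSpace.basisFun (Fin 3) ℝ 1)
  have h2 := hG 0 (EuclideanSpace.basisFun (Fin 3) ℝ 2)
  rw [he, one_pow, mul_one, real_inner_comm] at h0 h1 h2
  linarith

/-- **Chebyshev in time**: a function continuous on `[a, b]` (`a < b`) with `∫ₐᵇ Z ≤ D` takes a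
value `≤ D/(b − a)` somewhere on `[a, b]` (it attains its minimum `m`, and `m(b − a) ≤ ∫ₐᵇ Z`).
[folklore] -/
private theorem h2s_exists_mem_Icc_le_div {Z : ℝ → ℝ} {a b D : ℝ} (hab : a < b)
    (hZ : ContinuousOn Z (Icc a b)) (hD : ∫ s in a..b, Z s ≤ D) :
    ∃ c ∈ Icc a b, Z c ≤ D / (b - a) := by
  obtain ⟨c, hc, hmin⟩ := isCompact_Icc.exists_isMinOn (nonempty_Icc.2 hab.le) hZ
  refine ⟨c, hc, ?_⟩
  have hle : ∀ s ∈ Icc a b, Z c ≤ Z s := fun s hs => hmin hs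
  have hconst : ∫ s in a..b, Z c = Z c * (b - a) := by
    rw [intervalIntegral.integral_const, smul_eq_mul, mul_comm]
  have hmono : ∫ s in a..b, Z c ≤ ∫ s in a..b, Z s :=
    intervalIntegral.integral_mono_on hab.le intervalIntegrable_const
      (hZ.intervalIntegrable_of_Icc hab.le) hle
  rw [hconst] at hmono
  rw [le_div_iff₀ (sub_pos.2 hab)]
  exact hmono.trans hD

end Helpers

/-! ## §G `H¹ → H²` smoothing on the second half of the window -/

section Smoothing

variable {ν T : ℝ} {f g u v : ℝ → EuclideanSpace ℝ (Fin 3) → EuclideanSpace ℝ (Fin 3)}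
variable {p q : ℝ → EuclideanSpace ℝ (Fin 3) → ℝ}

/-- **`H¹ → H²` parabolic smoothing of the difference of two classical solutions on `ℝ³`, strain
form, a priori (Constantin–Foias 1988 Ch. 10 / RRS 2016 Thm 6.8, Chebyshev form, composed with
Dashti–Robinson's `H²` letter).** Let `(u, p)` (force `f`, the reference) and `(v, q)` (force `g`)
be classical solutions on `[0, T] × ℝ³` (`T > 0`) in the `L²`-Sobolev class, and let continuous
majorants on `[0, T]` be given: `G` (compression rate of `Du`), `σ₂ ≥ ‖D²u‖_∞`, `σ₃ ≥ ‖D³u‖_∞`,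
`L ≥ ‖(v − u)(s)‖_{L²}`, `X₁ ≥ ∫|∇(v − u)(s)|²_F`, `H₀ ≥ ∫‖(f − g)(s)‖²`,
`H₁ ≥ ∫‖D(f − g)(s)‖²`, `ψ ≥ 27σ₂X₁/κ + 9σ₃L²/κ² + 6H₁/ν` (free lengths `κ, μ > 0`). Put
`φ = (4G + 3κσ₂)X₁ + 4A⁴X₁³/ν³ + 4H₀/ν + 3σ₂L²/κ`, let `D ≥ X₁(0) + ∫₀ᵀ φ` (a bound of the
DISSIPATION BUDGET `ν∫₀ᵀ∫‖Δ(v − u)‖²`, `dissipation_sub_le_R3`), `Ψ₂ ≥ ∫₀ᵀ ψ`,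
`l = 6G + 9κσ₂ + 3κ²σ₃ + 3A²X₁/(νμ) + 27A⁴X₁²/(16ν³)`, `β = A²μ/ν`, `η = 2D/(νT) + Ψ₂`.
If `βe^{∫₀ᵀ l}ηT < 1`, then for every `t ∈ [T/2, T]`
`Σᵢ∫|∇∂ᵢ(v − u)(t)|²_F ≤ e^{∫₀ᵗ l}η/(1 − βe^{∫₀ᵀ l}ηT)` — NO hypothesis on the `H²` defect at
time `0`. Proof: by the dissipation budget and Chebyshev there is `a ∈ [0, T/2]` with
`Z(a) = ∫‖Δ(v − u)(a)‖² ≤ 2D/(νT)`; run `classicalNS_robustness_H2_strain_window_of_le_R3` on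
`[a, T]`. [cite: ConstantinFoias1988, Ch. 10 (proof of Thm 10.6); DashtiRobinson2008, Thm 2] -/
theorem classicalNS_H2_smoothing_strain_R3 (hν : 0 < ν) (hT : 0 < T)
    (hv : IsClassicalNSSolutionOn (Icc 0 T) ν g v q) (hu : IsClassicalNSSolutionOn (Icc 0 T) ν f u p)
    (hU : HasBoundedSobolevNormsOn (Icc 0 T) u)
    (hUt : HasBoundedSobolevNormsOn (Icc 0 T) (timeDerivWithin (Icc 0 T) u))
    (hp : ∀ n : ℕ, ∃ C : ℝ≥0, ∀ t ∈ Icc 0 T, ∫⁻ x, ‖iteratedFDeriv ℝ n (p t) x‖ₑ ^ 2 ≤ C)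
    (hV : HasBoundedSobolevNormsOn (Icc 0 T) v)
    (hVt : HasBoundedSobolevNormsOn (Icc 0 T) (timeDerivWithin (Icc 0 T) v))
    (hq : ∀ n : ℕ, ∃ C : ℝ≥0, ∀ t ∈ Icc 0 T, ∫⁻ x, ‖iteratedFDeriv ℝ n (q t) x‖ₑ ^ 2 ≤ C)
    {G σ₂ σ₃ L X₁ H₀ H₁ ψ : ℝ → ℝ} {κ μ D Ψ₂ : ℝ} (hκ : 0 < κ) (hμ : 0 < μ)
    (hG : ∀ s ∈ Icc 0 T, ∀ (x ξ : EuclideanSpace ℝ (Fin 3)), -⟪fderiv ℝ (u s) x ξ, ξ⟫ ≤ G s * ‖ξ‖ ^ 2)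
    (hσ₂ : ∀ s ∈ Icc 0 T, ∀ x, ‖iteratedFDeriv ℝ 2 (u s) x‖ ≤ σ₂ s)
    (hσ₃ : ∀ s ∈ Icc 0 T, ∀ x, ‖iteratedFDeriv ℝ 3 (u s) x‖ ≤ σ₃ s)
    (hL : ∀ s ∈ Icc 0 T, Real.sqrt (∫ x, ‖(v - u) s x‖ ^ 2) ≤ L s)
    (hX₁ : ∀ s ∈ Icc 0 T, ∫ x, frobeniusNormSq (fderiv ℝ ((v - u) s) x) ≤ X₁ s)
    (hH₀ : ∀ s ∈ Icc 0 T, ∫ x, ‖f s x - g s x‖ ^ 2 ≤ H₀ s)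
    (hH₁ : ∀ s ∈ Icc 0 T, ∫ x, ‖fderiv ℝ (fun y => f s y - g s y) x‖ ^ 2 ≤ H₁ s)
    (hψ : ∀ s ∈ Icc 0 T,
      27 * σ₂ s / κ * X₁ s + 9 * σ₃ s / κ ^ 2 * L s ^ 2 + 6 / ν * H₁ s ≤ ψ s)
    (hGc : ContinuousOn G (Icc 0 T)) (hσ₂c : ContinuousOn σ₂ (Icc 0 T))
    (hσ₃c : ContinuousOn σ₃ (Icc 0 T)) (hLc : ContinuousOn L (Icc 0 T))
    (hX₁c : ContinuousOn X₁ (Icc 0 T)) (hH₀c : ContinuousOn H₀ (Icc 0 T))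
    (hH₁c : ContinuousOn H₁ (Icc 0 T)) (hψc : ContinuousOn ψ (Icc 0 T))
    (hD : X₁ 0 + ∫ s in (0 : ℝ)..T, ((4 * G s + 3 * κ * σ₂ s) * X₁ s +
        4 * agmonConst ^ 4 * X₁ s ^ 3 / ν ^ 3 + 4 / ν * H₀ s + 3 * σ₂ s / κ * L s ^ 2) ≤ D)
    (hΨ₂ : ∫ s in (0 : ℝ)..T, ψ s ≤ Ψ₂)
    (hsmall : agmonConst ^ 2 * μ / ν *
        Real.exp (∫ s in (0 : ℝ)..T, (6 * G s + 9 * κ * σ₂ s + 3 * κ ^ 2 * σ₃ s +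
          3 * agmonConst ^ 2 * X₁ s / (ν * μ) + 27 * agmonConst ^ 4 * X₁ s ^ 2 / (16 * ν ^ 3))) *
      (2 * D / (ν * T) + Ψ₂) * T < 1)
    {t : ℝ} (ht : t ∈ Icc (T / 2) T) :
    (∑ i, ∫ x, frobeniusNormSq (fderiv ℝ (fun y => fderiv ℝ ((v - u) t) y
        (EuclideanSpace.basisFun (Fin 3) ℝ i)) x)) ≤
      Real.exp (∫ s in (0 : ℝ)..t, (6 * G s + 9 * κ * σ₂ s + 3 * κ ^ 2 * σ₃ s +
          3 * agmonConst ^ 2 * X₁ s / (ν * μ) + 27 * agmonConst ^ 4 * X₁ s ^ 2 / (16 * ν ^ 3))) *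
          (2 * D / (ν * T) + Ψ₂) /
        (1 - agmonConst ^ 2 * μ / ν *
          Real.exp (∫ s in (0 : ℝ)..T, (6 * G s + 9 * κ * σ₂ s + 3 * κ ^ 2 * σ₃ s +
            3 * agmonConst ^ 2 * X₁ s / (ν * μ) + 27 * agmonConst ^ 4 * X₁ s ^ 2 / (16 * ν ^ 3))) *
          (2 * D / (ν * T) + Ψ₂) * T) := by
  have hU' : UniqueDiffOn ℝ (Icc 0 T) := uniqueDiffOn_Icc hT
  -- the rate as one function
  obtain ⟨l, hl⟩ : ∃ l : ℝ → ℝ, l = fun s => 6 * G s + 9 * κ * σ₂ s + 3 * κ ^ 2 * σ₃ s +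
      3 * agmonConst ^ 2 * X₁ s / (ν * μ) + 27 * agmonConst ^ 4 * X₁ s ^ 2 / (16 * ν ^ 3) :=
    ⟨_, rfl⟩
  have hl' : ∀ s, 6 * G s + 9 * κ * σ₂ s + 3 * κ ^ 2 * σ₃ s +
      3 * agmonConst ^ 2 * X₁ s / (ν * μ) + 27 * agmonConst ^ 4 * X₁ s ^ 2 / (16 * ν ^ 3) = l s :=
    fun s => by rw [hl]
  simp only [hl'] at hsmall ⊢
  -- abbreviations for the constant and the defect majorant
  obtain ⟨c, hc⟩ : ∃ c : ℝ, c = agmonConst ^ 2 * μ / ν := ⟨_, rfl⟩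
  obtain ⟨η, hη⟩ : ∃ η : ℝ, η = 2 * D / (ν * T) + Ψ₂ := ⟨_, rfl⟩
  simp only [← hc, ← hη] at hsmall ⊢
  -- signs
  have hA := agmonConst_nonneg
  have hc0 : 0 ≤ c := by rw [hc]; positivity
  have hG0 : ∀ s ∈ Icc 0 T, 0 ≤ G s := fun s hs =>
    h2s_compressionRate_nonneg (hu.divFree s hs) (hG s hs)
  have hσ₂0 : ∀ s ∈ Icc 0 T, 0 ≤ σ₂ s := fun s hs => (norm_nonneg _).trans (hσ₂ s hs 0)
  have hσ₃0 : ∀ s ∈ Icc 0 T, 0 ≤ σ₃ s := fun s hs => (norm_nonneg _).trans (hσ₃ s hs 0)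
  have hX₁0 : ∀ s ∈ Icc 0 T, 0 ≤ X₁ s := fun s hs =>
    (integral_nonneg fun x => frobeniusNormSq_nonneg _).trans (hX₁ s hs)
  have hH₀0 : ∀ s ∈ Icc 0 T, 0 ≤ H₀ s := fun s hs =>
    (integral_nonneg fun x => sq_nonneg _).trans (hH₀ s hs)
  have hH₁0 : ∀ s ∈ Icc 0 T, 0 ≤ H₁ s := fun s hs =>
    (integral_nonneg fun x => sq_nonneg _).trans (hH₁ s hs)
  have hψ0 : ∀ s ∈ Icc 0 T, 0 ≤ ψ s := fun s hs => by
    refine le_trans ?_ (hψ s hs)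
    have := hσ₂0 s hs; have := hσ₃0 s hs; have := hX₁0 s hs; have := hH₁0 s hs
    positivity
  have hl0 : ∀ s ∈ Icc 0 T, 0 ≤ l s := fun s hs => by
    rw [hl]
    have := hG0 s hs; have := hσ₂0 s hs; have := hσ₃0 s hs; have := hX₁0 s hs
    positivity
  have hφ0 : ∀ s ∈ Icc 0 T, 0 ≤ (4 * G s + 3 * κ * σ₂ s) * X₁ s +
      4 * agmonConst ^ 4 * X₁ s ^ 3 / ν ^ 3 + 4 / ν * H₀ s + 3 * σ₂ s / κ * L s ^ 2 := fun s hs => by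
    have := hG0 s hs; have := hσ₂0 s hs; have := hX₁0 s hs; have := hH₀0 s hs
    positivity
  have hlc : ContinuousOn l (Icc 0 T) := by
    rw [hl]
    exact ((((continuousOn_const.mul hGc).add (continuousOn_const.mul hσ₂c)).add
      (continuousOn_const.mul hσ₃c)).add
      ((continuousOn_const.mul hX₁c).div_const _)).add
      ((continuousOn_const.mul (hX₁c.pow 2)).div_const _)
  have hφc : ContinuousOn (fun s => (4 * G s + 3 * κ * σ₂ s) * X₁ s +
      4 * agmonConst ^ 4 * X₁ s ^ 3 / ν ^ 3 + 4 / ν * H₀ s + 3 * σ₂ s / κ * L s ^ 2) (Icc 0 T) :=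
    (((((continuousOn_const.mul hGc).add (continuousOn_const.mul hσ₂c)).mul hX₁c).add
      (((continuousOn_const.mul (hX₁c.pow 3)).div_const _))).add
      (continuousOn_const.mul hH₀c)).add
      (((continuousOn_const.mul hσ₂c).div_const _).mul (hLc.pow 2))
  -- nonnegativity of `D`, `Ψ₂`, `η`
  have hΨ0 : 0 ≤ ∫ s in (0 : ℝ)..T, ψ s := intervalIntegral.integral_nonneg hT.le hψ0
  have hΨ₂0 : 0 ≤ Ψ₂ := hΨ0.trans hΨ₂
  have hD0 : 0 ≤ D := by
    refine le_trans ?_ hD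
    exact add_nonneg (hX₁0 0 ⟨le_rfl, hT.le⟩) (intervalIntegral.integral_nonneg hT.le hφ0)
  have hη0 : 0 ≤ η := by rw [hη]; positivity
  -- STEP 1: the dissipation budget on `[0, T/2]` and Chebyshev
  have hT2 : T / 2 ∈ Icc 0 T := ⟨by positivity, by linarith⟩
  have hT2pos : 0 < T / 2 := by positivity
  obtain ⟨heqZ, hYc⟩ := hv.hessianDefect_eq_laplacian_and_continuousOn hT hu hU hUt hp hV hVt hq
  have hbudget := hv.dissipation_sub_le_R3 hν hT hu hU hUt hp hV hVt hq hκ hG hσ₂ hL hX₁ hH₀ hGc hσ₂c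
    hLc hX₁c hH₀c hT2
  have hX00 : (∫ x, frobeniusNormSq (fderiv ℝ ((v - u) 0) x)) ≤ X₁ 0 := hX₁ 0 ⟨le_rfl, hT.le⟩
  have hXT2 : 0 ≤ ∫ x, frobeniusNormSq (fderiv ℝ ((v - u) (T / 2)) x) :=
    integral_nonneg fun x => frobeniusNormSq_nonneg _
  have hφmono : (∫ s in (0 : ℝ)..(T / 2), ((4 * G s + 3 * κ * σ₂ s) * X₁ s +
        4 * agmonConst ^ 4 * X₁ s ^ 3 / ν ^ 3 + 4 / ν * H₀ s + 3 * σ₂ s / κ * L s ^ 2)) ≤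
      ∫ s in (0 : ℝ)..T, ((4 * G s + 3 * κ * σ₂ s) * X₁ s +
        4 * agmonConst ^ 4 * X₁ s ^ 3 / ν ^ 3 + 4 / ν * H₀ s + 3 * σ₂ s / κ * L s ^ 2) := by
    refine intervalIntegral.integral_mono_interval le_rfl hT2pos.le (by linarith) ?_
      (hφc.intervalIntegrable_of_Icc hT.le)
    exact (ae_restrict_iff' measurableSet_Ioc).2 (Eventually.of_forall fun s hs =>
      hφ0 s ⟨hs.1.le, hs.2⟩)
  have hint : (∫ s in (0 : ℝ)..(T / 2), ∫ x, ‖(Δ ((v - u) s)) x‖ ^ 2) ≤ D / ν := by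
    rw [le_div_iff₀ hν]
    have : ν * (∫ s in (0 : ℝ)..(T / 2), ∫ x, ‖(Δ ((v - u) s)) x‖ ^ 2) ≤ D := by linarith
    linarith
  obtain ⟨a, ha, hZa⟩ := h2s_exists_mem_Icc_le_div hT2pos
    (hYc.mono (Icc_subset_Icc_right hT2.2)) hint
  rw [sub_zero] at hZa
  have haT : a ∈ Icc 0 T := ⟨ha.1, ha.2.trans hT2.2⟩
  have hZa' : (∑ i, ∫ x, frobeniusNormSq (fderiv ℝ (fun y => fderiv ℝ ((v - u) a) y
      (EuclideanSpace.basisFun (Fin 3) ℝ i)) x)) ≤ 2 * D / (ν * T) := by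
    rw [heqZ a haT]
    refine hZa.trans (le_of_eq ?_)
    field_simp
  -- STEP 2: restrict everything to `[a, T]`
  have halt : a < T := lt_of_le_of_lt ha.2 (by linarith)
  have hsub : Icc a T ⊆ Icc 0 T := Icc_subset_Icc_left ha.1
  have hUa : UniqueDiffOn ℝ (Icc a T) := uniqueDiffOn_Icc halt
  have hv' : IsClassicalNSSolutionOn (Icc a T) ν g v q := hv.mono hsub hUa
  have hu' : IsClassicalNSSolutionOn (Icc a T) ν f u p := hu.mono hsub hUa
  have hWeq : ∀ {w : ℝ → EuclideanSpace ℝ (Fin 3) → EuclideanSpace ℝ (Fin 3)},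
      IsSmoothSpaceTimeOn (Icc 0 T) w → ∀ s ∈ Icc a T,
        timeDerivWithin (Icc a T) w s = timeDerivWithin (Icc 0 T) w s := fun hw s hs =>
    funext fun x => hw.timeDerivWithin_eq_of_subset hsub hUa hs x
  have hUt' : HasBoundedSobolevNormsOn (Icc a T) (timeDerivWithin (Icc a T) u) := by
    intro n
    obtain ⟨C, hC⟩ := hUt n
    exact ⟨C, fun s hs => by rw [hWeq hu.smooth_velocity s hs]; exact hC s (hsub hs)⟩
  have hVt' : HasBoundedSobolevNormsOn (Icc a T) (timeDerivWithin (Icc a T) v) := by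
    intro n
    obtain ⟨C, hC⟩ := hVt n
    exact ⟨C, fun s hs => by rw [hWeq hv.smooth_velocity s hs]; exact hC s (hsub hs)⟩
  have hp' : ∀ n : ℕ, ∃ C : ℝ≥0, ∀ t ∈ Icc a T, ∫⁻ x, ‖iteratedFDeriv ℝ n (p t) x‖ₑ ^ 2 ≤ C :=
    fun n => (hp n).imp fun _ hC t ht => hC t (hsub ht)
  have hq' : ∀ n : ℕ, ∃ C : ℝ≥0, ∀ t ∈ Icc a T, ∫⁻ x, ‖iteratedFDeriv ℝ n (q t) x‖ₑ ^ 2 ≤ C :=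
    fun n => (hq n).imp fun _ hC t ht => hC t (hsub ht)
  have hfD' : ∀ t ∈ Icc a T, ∫⁻ x, ‖fderiv ℝ (f t) x‖ₑ ^ 2 < ⊤ := fun t ht =>
    hu.lintegral_enorm_sq_fderiv_force_lt_top hU' hU hUt hp (hsub ht)
  have hgD' : ∀ t ∈ Icc a T, ∫⁻ x, ‖fderiv ℝ (g t) x‖ₑ ^ 2 < ⊤ := fun t ht =>
    hv.lintegral_enorm_sq_fderiv_force_lt_top hU' hV hVt hq (hsub ht)
  -- the source and rate on the sub-window
  have hΨa : (∫ s in a..T, ψ s) ≤ Ψ₂ := by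
    refine le_trans ?_ hΨ₂
    refine intervalIntegral.integral_mono_interval ha.1 halt.le le_rfl ?_
      (hψc.intervalIntegrable_of_Icc hT.le)
    exact (ae_restrict_iff' measurableSet_Ioc).2 (Eventually.of_forall fun s hs =>
      hψ0 s ⟨hs.1.le, hs.2⟩)
  have hla : ∀ {s₁ s₂ : ℝ}, 0 ≤ s₁ → s₁ ≤ s₂ → s₂ ≤ T →
      (∫ s in s₁..s₂, l s) ≤ ∫ s in (0 : ℝ)..s₂, l s := fun h1 h12 h2T => by
    refine intervalIntegral.integral_mono_interval h1 h12 le_rfl ?_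
      ((hlc.mono (Icc_subset_Icc_right h2T)).intervalIntegrable_of_Icc (h1.trans h12))
    exact (ae_restrict_iff' measurableSet_Ioc).2 (Eventually.of_forall fun s hs =>
      hl0 s ⟨hs.1.le, hs.2.trans h2T⟩)
  have hexpT : Real.exp (∫ s in a..T, l s) ≤ Real.exp (∫ s in (0 : ℝ)..T, l s) :=
    Real.exp_le_exp.2 (hla ha.1 halt.le le_rfl)
  have hsmall' : c * Real.exp (∫ s in a..T, l s) * (2 * D / (ν * T) + Ψ₂) * (T - a) < 1 := by
    have h1 : c * Real.exp (∫ s in a..T, l s) * (2 * D / (ν * T) + Ψ₂) * (T - a) ≤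
        c * Real.exp (∫ s in (0 : ℝ)..T, l s) * η * T := by
      rw [← hη]
      have hTa : T - a ≤ T := by linarith [ha.1]
      have hTa0 : 0 ≤ T - a := by linarith
      calc c * Real.exp (∫ s in a..T, l s) * η * (T - a)
          ≤ c * Real.exp (∫ s in (0 : ℝ)..T, l s) * η * (T - a) := by
            gcongr
        _ ≤ c * Real.exp (∫ s in (0 : ℝ)..T, l s) * η * T := by
            gcongr
    exact lt_of_le_of_lt h1 hsmall
  -- STEP 3: the `H²` letter on `[a, T]`
  have hta : t ∈ Icc a T := ⟨ha.2.trans ht.1, ht.2⟩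
  have key := classicalNS_robustness_H2_strain_window_of_le_R3 hν halt hv' hu' (hU.mono hsub) hUt' hp'
    (hV.mono hsub) hVt' hq' hfD' hgD' hκ hμ
    (fun s hs => hG s (hsub hs)) (fun s hs => hσ₂ s (hsub hs)) (fun s hs => hσ₃ s (hsub hs))
    (fun s hs => hL s (hsub hs)) (fun s hs => hX₁ s (hsub hs)) (fun s hs => hH₁ s (hsub hs))
    (fun s hs => hψ s (hsub hs)) (hGc.mono hsub) (hσ₂c.mono hsub) (hσ₃c.mono hsub) (hLc.mono hsub)
    (hX₁c.mono hsub) (hH₁c.mono hsub) (hψc.mono hsub) hZa' hΨa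
    (by simp only [hl', ← hc]; exact hsmall') hta
  simp only [hl', ← hc, ← hη] at key
  -- STEP 4: monotonicity of the bound in `a`
  refine key.trans ?_
  have hnum : Real.exp (∫ s in a..t, l s) * η ≤ Real.exp (∫ s in (0 : ℝ)..t, l s) * η :=
    mul_le_mul_of_nonneg_right (Real.exp_le_exp.2 (hla ha.1 hta.1 ht.2)) hη0
  have hden : 1 - c * Real.exp (∫ s in (0 : ℝ)..T, l s) * η * T ≤
      1 - c * Real.exp (∫ s in a..T, l s) * η * (t - a) := by
    have hTa : t - a ≤ T := by linarith [ha.1, ht.2]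
    have hta0 : 0 ≤ t - a := by linarith [hta.1]
    have : c * Real.exp (∫ s in a..T, l s) * η * (t - a) ≤
        c * Real.exp (∫ s in (0 : ℝ)..T, l s) * η * T := by
      calc c * Real.exp (∫ s in a..T, l s) * η * (t - a)
          ≤ c * Real.exp (∫ s in (0 : ℝ)..T, l s) * η * (t - a) := by gcongr
        _ ≤ c * Real.exp (∫ s in (0 : ℝ)..T, l s) * η * T := by
            gcongr
    linarith
  have hpos : 0 < 1 - c * Real.exp (∫ s in (0 : ℝ)..T, l s) * η * T := by linarith
  calc Real.exp (∫ s in a..t, l s) * η / (1 - c * Real.exp (∫ s in a..T, l s) * η * (t - a))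
      ≤ Real.exp (∫ s in a..t, l s) * η / (1 - c * Real.exp (∫ s in (0 : ℝ)..T, l s) * η * T) :=
        div_le_div_of_nonneg_left (mul_nonneg (Real.exp_pos _).le hη0) hpos hden
    _ ≤ Real.exp (∫ s in (0 : ℝ)..t, l s) * η / (1 - c * Real.exp (∫ s in (0 : ℝ)..T, l s) * η * T) :=
        div_le_div_of_nonneg_right hnum hpos.le

/-- **Sup-norm distance on the second half of the window from `H¹ / L²` data only** (the readout
the hybrid strain door uses): in the setting of `classicalNS_H2_smoothing_strain_R3`, for
`t ∈ [T/2, T]` and every `x`,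
`‖v(t,x) − u(t,x)‖ ≤ A(3X₁(t) · e^{∫₀ᵗ l}η/(1 − βe^{∫₀ᵀ l}ηT))^{1/4}` (Agmon,
`classicalNS_norm_sub_le_of_H1_H2_R3`). [cite: RobinsonRodrigoSadowskiCUP2016, Thm 1.20; DashtiRobinson2008, Thm 2] -/
theorem classicalNS_norm_sub_le_H2_smoothing_R3 (hν : 0 < ν) (hT : 0 < T)
    (hv : IsClassicalNSSolutionOn (Icc 0 T) ν g v q) (hu : IsClassicalNSSolutionOn (Icc 0 T) ν f u p)
    (hU : HasBoundedSobolevNormsOn (Icc 0 T) u)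
    (hUt : HasBoundedSobolevNormsOn (Icc 0 T) (timeDerivWithin (Icc 0 T) u))
    (hp : ∀ n : ℕ, ∃ C : ℝ≥0, ∀ t ∈ Icc 0 T, ∫⁻ x, ‖iteratedFDeriv ℝ n (p t) x‖ₑ ^ 2 ≤ C)
    (hV : HasBoundedSobolevNormsOn (Icc 0 T) v)
    (hVt : HasBoundedSobolevNormsOn (Icc 0 T) (timeDerivWithin (Icc 0 T) v))
    (hq : ∀ n : ℕ, ∃ C : ℝ≥0, ∀ t ∈ Icc 0 T, ∫⁻ x, ‖iteratedFDeriv ℝ n (q t) x‖ₑ ^ 2 ≤ C)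
    {G σ₂ σ₃ L X₁ H₀ H₁ ψ : ℝ → ℝ} {κ μ D Ψ₂ : ℝ} (hκ : 0 < κ) (hμ : 0 < μ)
    (hG : ∀ s ∈ Icc 0 T, ∀ (x ξ : EuclideanSpace ℝ (Fin 3)), -⟪fderiv ℝ (u s) x ξ, ξ⟫ ≤ G s * ‖ξ‖ ^ 2)
    (hσ₂ : ∀ s ∈ Icc 0 T, ∀ x, ‖iteratedFDeriv ℝ 2 (u s) x‖ ≤ σ₂ s)
    (hσ₃ : ∀ s ∈ Icc 0 T, ∀ x, ‖iteratedFDeriv ℝ 3 (u s) x‖ ≤ σ₃ s)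
    (hL : ∀ s ∈ Icc 0 T, Real.sqrt (∫ x, ‖(v - u) s x‖ ^ 2) ≤ L s)
    (hX₁ : ∀ s ∈ Icc 0 T, ∫ x, frobeniusNormSq (fderiv ℝ ((v - u) s) x) ≤ X₁ s)
    (hH₀ : ∀ s ∈ Icc 0 T, ∫ x, ‖f s x - g s x‖ ^ 2 ≤ H₀ s)
    (hH₁ : ∀ s ∈ Icc 0 T, ∫ x, ‖fderiv ℝ (fun y => f s y - g s y) x‖ ^ 2 ≤ H₁ s)
    (hψ : ∀ s ∈ Icc 0 T,
      27 * σ₂ s / κ * X₁ s + 9 * σ₃ s / κ ^ 2 * L s ^ 2 + 6 / ν * H₁ s ≤ ψ s)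
    (hGc : ContinuousOn G (Icc 0 T)) (hσ₂c : ContinuousOn σ₂ (Icc 0 T))
    (hσ₃c : ContinuousOn σ₃ (Icc 0 T)) (hLc : ContinuousOn L (Icc 0 T))
    (hX₁c : ContinuousOn X₁ (Icc 0 T)) (hH₀c : ContinuousOn H₀ (Icc 0 T))
    (hH₁c : ContinuousOn H₁ (Icc 0 T)) (hψc : ContinuousOn ψ (Icc 0 T))
    (hD : X₁ 0 + ∫ s in (0 : ℝ)..T, ((4 * G s + 3 * κ * σ₂ s) * X₁ s +
        4 * agmonConst ^ 4 * X₁ s ^ 3 / ν ^ 3 + 4 / ν * H₀ s + 3 * σ₂ s / κ * L s ^ 2) ≤ D)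
    (hΨ₂ : ∫ s in (0 : ℝ)..T, ψ s ≤ Ψ₂)
    (hsmall : agmonConst ^ 2 * μ / ν *
        Real.exp (∫ s in (0 : ℝ)..T, (6 * G s + 9 * κ * σ₂ s + 3 * κ ^ 2 * σ₃ s +
          3 * agmonConst ^ 2 * X₁ s / (ν * μ) + 27 * agmonConst ^ 4 * X₁ s ^ 2 / (16 * ν ^ 3))) *
      (2 * D / (ν * T) + Ψ₂) * T < 1)
    {t : ℝ} (ht : t ∈ Icc (T / 2) T) (x : EuclideanSpace ℝ (Fin 3)) :
    ‖v t x - u t x‖ ≤ agmonConst * (3 * X₁ t *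
      (Real.exp (∫ s in (0 : ℝ)..t, (6 * G s + 9 * κ * σ₂ s + 3 * κ ^ 2 * σ₃ s +
          3 * agmonConst ^ 2 * X₁ s / (ν * μ) + 27 * agmonConst ^ 4 * X₁ s ^ 2 / (16 * ν ^ 3))) *
          (2 * D / (ν * T) + Ψ₂) /
        (1 - agmonConst ^ 2 * μ / ν *
          Real.exp (∫ s in (0 : ℝ)..T, (6 * G s + 9 * κ * σ₂ s + 3 * κ ^ 2 * σ₃ s +
            3 * agmonConst ^ 2 * X₁ s / (ν * μ) + 27 * agmonConst ^ 4 * X₁ s ^ 2 / (16 * ν ^ 3))) *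
          (2 * D / (ν * T) + Ψ₂) * T))) ^ (1 / 4 : ℝ) := by
  have ht' : t ∈ Icc 0 T := ⟨le_trans (by positivity) ht.1, ht.2⟩
  exact classicalNS_norm_sub_le_of_H1_H2_R3 hv hu hU hV ht' (hX₁ t ht')
    (classicalNS_H2_smoothing_strain_R3 hν hT hv hu hU hUt hp hV hVt hq hκ hμ hG hσ₂ hσ₃ hL hX₁ hH₀ hH₁
      hψ hGc hσ₂c hσ₃c hLc hX₁c hH₀c hH₁c hψc hD hΨ₂ hsmall ht) x

end Smoothing

end Literature.Analysis.FluidPDE
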